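import Mathlib
import HarnessLib
import Summits.HubbardSuperconductivity.HubbardSuperconductivity.Theorems.ComplexGFFStiffnessDefs
import Summits.HubbardSuperconductivity.HubbardSuperconductivity.Theorems.ComplexGFFStiffnessHypALocalTwoPointReduction

/-!
# Crux `HypALocalTwoPoint`, line `gnv` — the line `s ↦ K + s·G·(1+K)` stays in the admissible ball

Route `route-HubbardSuperconductivity-ComplexGFFStiffness`, crux item stmt-HubbardSuperconductivity-19155,
reduction of `stub_twoPointGivenZ` to `OnePointLipschitz` (census entry (C1), admissibility half): if the
perturbation `K` and the observable `G` are `ι`-admissible with Gaussian weight `exp(|z|²/8)` and sizes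
`ρ`, `γ`, then for every real `s` the perturbed interaction `K + s·G·(1+K)` — whose `s`-derivative at
`0` produces the one-point function `onePoint n K G` (`…OnePointDerivative`) — is `ι`-admissible in the
reference's class `IsIotaAdmissible` (weight `exp(|z|²/4)`) with size `ρ + |s|·2^{r₀}γ(1+ρ)`
(Leibniz rule; the two weights `exp(|z|²/8)` multiply to `exp(|z|²/4)`; `s` real keeps the
`ι`-symmetry).  So `GNV` and the tuned renormalisation-group flow apply along the line for `|s|` small.

* `norm_iteratedFDeriv_obs_mul_one_add_le` — `‖D^k (G·(1+K))(z)‖ ≤ 2^{r₀} γ (1+ρ) e^{|z|²/4}`;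
* `isIotaAdmissible_linePert` — the statement above.

## References
* S. Adams, S. Buchholz, R. Kotecký, S. Müller, arXiv:1910.13564, Sec. 2.1 (the ball of `E_{ζ,𝒬}`),
  Theorem 2.2 [AdamsBuchholzKoteckyMuller2019].
-/

noncomputable section

-- `Summit.<Summit>.<Problem>`: single-conjunct summit, the duplicate component is mandated (D-0017).
set_option linter.dupNamespace false

namespace Summit.HubbardSuperconductivity.HubbardSuperconductivity.Theorems.ComplexGFF

open scoped BigOperators ComplexConjugate

/-- **Leibniz bound for the observable-weighted site factor**: if `‖D^j G‖ ≤ γ e^{|z|²/8}` and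
`‖D^j K‖ ≤ ρ e^{|z|²/8}` for `j ≤ r₀` (`γ, ρ ≥ 0`), then `‖D^k (G·(1+K))(z)‖ ≤ 2^{r₀} γ (1+ρ) e^{Σ z_i²/4}`
for `k ≤ r₀`. -/
theorem norm_iteratedFDeriv_obs_mul_one_add_le {r₀ : ℕ} {ρ γ : ℝ} (hρ : 0 ≤ ρ) (hγ : 0 ≤ γ)
    {K G : (Fin 4 → ℝ) → ℂ} (hK : IsIotaAdmissibleWt r₀ (1 / 8) ρ K) (hG : IsIotaAdmissibleWt r₀ (1 / 8) γ G)
    {k : ℕ} (hk : k ≤ r₀) (z : Fin 4 → ℝ) :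
    ‖iteratedFDeriv ℝ k (fun z => G z * (1 + K z)) z‖
      ≤ 2 ^ r₀ * γ * (1 + ρ) * Real.exp ((∑ i : Fin 4, (z i) ^ 2) / 4) := by
  obtain ⟨hKd, hKb, -⟩ := hK
  obtain ⟨hGd, hGb, -⟩ := hG
  set W : ℝ := Real.exp (1 / 8 * ∑ i : Fin 4, (z i) ^ 2) with hW
  have hW0 : 0 < W := Real.exp_pos _
  have hW1 : 1 ≤ W := Real.one_le_exp (by positivity)
  have hWW : W * W = Real.exp ((∑ i : Fin 4, (z i) ^ 2) / 4) := by
    rw [hW, ← Real.exp_add]; congr 1; ring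
  have hg : ContDiff ℝ r₀ (fun z : Fin 4 → ℝ => 1 + K z) := contDiff_const.add hKd
  -- derivatives of `1 + K`
  have hgb : ∀ j ≤ k, ‖iteratedFDeriv ℝ j (fun z : Fin 4 → ℝ => 1 + K z) z‖ ≤ (1 + ρ) * W := by
    intro j hj
    rcases Nat.eq_zero_or_pos j with rfl | hj0
    · rw [norm_iteratedFDeriv_zero]
      have h0 := hKb 0 (Nat.zero_le _) z
      rw [norm_iteratedFDeriv_zero] at h0
      calc ‖1 + K z‖ ≤ ‖(1 : ℂ)‖ + ‖K z‖ := norm_add_le _ _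
        _ ≤ 1 * W + ρ * W := by rw [norm_one]; exact add_le_add (by linarith) h0
        _ = (1 + ρ) * W := by ring
    · have hjr : j ≤ r₀ := hj.trans hk
      have hfun : (fun z : Fin 4 → ℝ => 1 + K z) = (fun _ => (1 : ℂ)) + K := by funext y; rfl
      rw [hfun, iteratedFDeriv_add_apply contDiff_const.contDiffAt
        ((hKd.of_le (by exact_mod_cast hjr)).contDiffAt), iteratedFDeriv_const_of_ne hj0.ne',
        Pi.zero_apply, zero_add]
      calc ‖iteratedFDeriv ℝ j K z‖ ≤ ρ * W := hKb j hjr z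
        _ ≤ (1 + ρ) * W := by nlinarith
  have hL := norm_iteratedFDeriv_mul_le (N := (r₀ : WithTop ℕ∞)) hGd hg z (n := k) (by exact_mod_cast hk)
  refine hL.trans ?_
  calc ∑ j ∈ Finset.range (k + 1), (k.choose j : ℝ) * ‖iteratedFDeriv ℝ j G z‖ *
        ‖iteratedFDeriv ℝ (k - j) (fun z : Fin 4 → ℝ => 1 + K z) z‖
      ≤ ∑ j ∈ Finset.range (k + 1), (k.choose j : ℝ) * (γ * W) * ((1 + ρ) * W) := by
        refine Finset.sum_le_sum fun j hj => ?_
        have hjk : j ≤ k := Nat.lt_succ_iff.mp (Finset.mem_range.mp hj)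
        have h1 := hGb j (hjk.trans hk) z
        have h2 := hgb (k - j) (Nat.sub_le _ _)
        have h3 : 0 ≤ (k.choose j : ℝ) * ‖iteratedFDeriv ℝ j G z‖ := by positivity
        calc (k.choose j : ℝ) * ‖iteratedFDeriv ℝ j G z‖ *
              ‖iteratedFDeriv ℝ (k - j) (fun z : Fin 4 → ℝ => 1 + K z) z‖
            ≤ (k.choose j : ℝ) * ‖iteratedFDeriv ℝ j G z‖ * ((1 + ρ) * W) :=
              mul_le_mul_of_nonneg_left h2 h3
          _ ≤ (k.choose j : ℝ) * (γ * W) * ((1 + ρ) * W) := by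
              refine mul_le_mul_of_nonneg_right (mul_le_mul_of_nonneg_left h1 (by positivity)) ?_
              positivity
    _ = 2 ^ k * (γ * (1 + ρ)) * (W * W) := by
        rw [← Finset.sum_mul, ← Finset.sum_mul]
        have : ∑ j ∈ Finset.range (k + 1), (k.choose j : ℝ) = 2 ^ k := by exact_mod_cast Nat.sum_range_choose k
        rw [this]; ring
    _ ≤ 2 ^ r₀ * (γ * (1 + ρ)) * (W * W) := by
        refine mul_le_mul_of_nonneg_right (mul_le_mul_of_nonneg_right
          (pow_le_pow_right₀ (by norm_num) hk) (by positivity)) (by positivity)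
    _ = 2 ^ r₀ * γ * (1 + ρ) * Real.exp ((∑ i : Fin 4, (z i) ^ 2) / 4) := by rw [hWW]; ring

/-- **The line `K + s·G·(1+K)` is `ι`-admissible** (module docstring): for `K`, `G` admissible with
weight `exp(|z|²/8)` and sizes `ρ, γ ≥ 0`, and real `s`,
`IsIotaAdmissible r₀ (ρ + |s|·2^{r₀}γ(1+ρ)) (z ↦ K z + s·G z·(1 + K z))`. -/
theorem isIotaAdmissible_linePert {r₀ : ℕ} {ρ γ : ℝ} (hρ : 0 ≤ ρ) (hγ : 0 ≤ γ)
    {K G : (Fin 4 → ℝ) → ℂ} (hK : IsIotaAdmissibleWt r₀ (1 / 8) ρ K) (hG : IsIotaAdmissibleWt r₀ (1 / 8) γ G)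
    (s : ℝ) :
    IsIotaAdmissible r₀ (ρ + |s| * (2 ^ r₀ * γ * (1 + ρ)))
      (fun z => K z + (s : ℂ) * (G z * (1 + K z))) := by
  have hKd := hK.1
  have hKb := hK.2.1
  have hKι := hK.2.2
  have hGd := hG.1
  have hGι := hG.2.2
  have hH : ContDiff ℝ r₀ (fun z : Fin 4 → ℝ => G z * (1 + K z)) := hGd.mul (contDiff_const.add hKd)
  have hsH : ContDiff ℝ r₀ (fun z : Fin 4 → ℝ => (s : ℂ) * (G z * (1 + K z))) := contDiff_const.mul hH
  refine ⟨hKd.add hsH, fun k hk z => ?_, fun z => ?_⟩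
  · have hfun : (fun z : Fin 4 → ℝ => K z + (s : ℂ) * (G z * (1 + K z)))
        = K + (s : ℂ) • (fun z : Fin 4 → ℝ => G z * (1 + K z)) := by
      funext y; simp [Pi.add_apply, Pi.smul_apply]
    have hkr : (k : WithTop ℕ∞) ≤ r₀ := by exact_mod_cast hk
    have hsm : ContDiff ℝ k ((s : ℂ) • fun z : Fin 4 → ℝ => G z * (1 + K z)) :=
      (hH.of_le hkr).const_smul (s : ℂ)
    rw [hfun, iteratedFDeriv_add_apply (hKd.of_le hkr).contDiffAt hsm.contDiffAt,
      iteratedFDeriv_const_smul_apply (hH.of_le hkr).contDiffAt]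
    have h1 := hKb k hk z
    have h2 := norm_iteratedFDeriv_obs_mul_one_add_le hρ hγ hK hG hk z
    have hexp : Real.exp (1 / 8 * ∑ i : Fin 4, (z i) ^ 2) ≤ Real.exp ((∑ i : Fin 4, (z i) ^ 2) / 4) :=
      Real.exp_le_exp.mpr (by
        have h0 : 0 ≤ ∑ i : Fin 4, (z i) ^ 2 := Finset.sum_nonneg (fun i _ => sq_nonneg _)
        linarith)
    calc ‖iteratedFDeriv ℝ k K z + (s : ℂ) • iteratedFDeriv ℝ k (fun z : Fin 4 → ℝ => G z * (1 + K z)) z‖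
        ≤ ‖iteratedFDeriv ℝ k K z‖ + ‖(s : ℂ) • iteratedFDeriv ℝ k (fun z : Fin 4 → ℝ => G z * (1 + K z)) z‖ :=
          norm_add_le _ _
      _ ≤ ρ * Real.exp ((∑ i : Fin 4, (z i) ^ 2) / 4)
          + |s| * (2 ^ r₀ * γ * (1 + ρ) * Real.exp ((∑ i : Fin 4, (z i) ^ 2) / 4)) := by
          refine add_le_add (h1.trans (mul_le_mul_of_nonneg_left hexp hρ)) ?_
          rw [norm_smul, Complex.norm_real, Real.norm_eq_abs]
          exact mul_le_mul_of_nonneg_left h2 (abs_nonneg s)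
      _ = (ρ + |s| * (2 ^ r₀ * γ * (1 + ρ))) * Real.exp ((∑ i : Fin 4, (z i) ^ 2) / 4) := by ring
  · show K (-z) + (s : ℂ) * (G (-z) * (1 + K (-z))) = conj (K z + (s : ℂ) * (G z * (1 + K z)))
    rw [hKι z, hGι z, map_add, map_mul, map_mul, map_add, map_one, Complex.conj_ofReal]

end Summit.HubbardSuperconductivity.HubbardSuperconductivity.Theorems.ComplexGFF

end
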